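import Summits.AtomisticToContinuum.Crystallization.Theorems.FrustratedLawDichotomyMotifDoorE
import Summits.AtomisticToContinuum.Crystallization.Theorems.FrustratedLawDichotomyRobustGoodCoordination
import Summits.AtomisticToContinuum.Crystallization.Theorems.FrustratedLawDichotomyTextureFineShells

/-!
# FrustratedLawDichotomy · crux `AperiodicFrustratedLawGap` (stmt-AtomisticToContinuum-27623) — SHELL FLAG CERTIFICATES, part 1: BADNESS.
# Rotation-free, bijection-free, rational-data certificates of `¬ GoodAt η z c` / `¬ MaybeGoodAt η D z c` for one site of a finite configuration
# — the badness flag consumed by the periodic-block negative kernel `…PeriodicBlockViolation.not_pairLevelLaw_of_cell`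
# (decomp-a2c, prover hand 2, structural share, generation 16; critic row 567 (C)(2) «generic badness-certificate checker — one format, two
# users»: hand-1 supplies the witness cells; part 2 `…ShellGoodnessCert` is the capped-GOODNESS certificate)

Setting: `z : Fin M → ℝ³` injective, centre `c`.  Every hypothesis is a (strict or weak) inequality between SQUARED distances with rational
coefficients, or a membership in an explicit `Finset` of indices, so that a witness cell with rational coordinates discharges them by `norm_num`.
`q₀` is any lower bound of the squared nearest-neighbour distance of the centre (`∀ a ≠ c, q₀ ≤ |z a − z c|²`) and `a₁ ≠ c` any index (its
squared distance to the centre bounds the fit scale `d² = nn²` from ABOVE; take `a₁` = a nearest neighbour for the sharpest tests).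

§1 generic consequences of the two-shell fit clauses (pattern of unit vectors): radial window `(1 ± η')·d` of the shell map, `q₀ ≤ d² ≤ |z a₁ − z c|²`,
   every atom at squared distance `< 169/100·q₀` from the centre is a shell atom.
§2 BADNESS certificates `⟹ ¬ GoodAt η z c` (generic cores over a pattern `Pat`, then both kissing patterns):
   * `not_goodAt_of_radial`       — an atom `j` with `(1+η)²·|z a₁ − z c|² < |z j − z c|² < 169/100·q₀` (ANY `η`): the fit scale is pinned to the
     nearest-neighbour distance, so a first-shell atom more than `η·nn` beyond `nn` refutes every isometric fit (misfit ≥ radial spread);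
   * `not_goodAt_of_thirteen`     — thirteen atoms other than the centre at squared distance `< 169/100·q₀` (any `η`);
   * `not_goodAt_of_eleven`       — an index set of `≤ 11` elements containing every `a ≠ c` with `|z a − z c|² < 169/100·|z a₁ − z c|²` (`η ≤ 1/20`);
   * `not_goodAt_of_window`       — two first-shell atoms at squared mutual distance in `(121/100·|z a₁ − z c|², 17161/10000·q₀)` (`η ≤ 1/20`; the
     CNA dichotomy of `…RobustGoodSignature`: shell pairs are contacts `≤ 11/10·d` or far `≥ 131/100·d`);
   * `not_goodAt_of_fiveContacts` — a first-shell atom with five first-shell atoms at squared distance `< 17161/10000·q₀` from it (`η ≤ 1/20`;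
     both kissing patterns are `4`-regular — the icosahedral `555` signature fails here).
§3 glue to the kernel flag: `not_goodAtScale_of_not_goodAt`, `not_maybeGoodAt_of_not_goodAt` (+ an atom within `D`), `dist_le_of_sq_le`.
All `[folklore]`; 0 sorry; no definitions.
-/

noncomputable section

namespace Summit.AtomisticToContinuum.Crystallization.Theorems.FrustratedLawDichotomyShellBadnessCert

open scoped BigOperators RealInnerProductSpace
open Literature.Geometry.DiscreteGeometry
open Summit.AtomisticToContinuum.Crystallization.Theorems.ChargedEnergyGapNegative (E3)
open Summit.AtomisticToContinuum.Crystallization.Theorems.FrustratedLawDichotomyRangeCut (GoodAt)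
open Summit.AtomisticToContinuum.Crystallization.Theorems.FrustratedLawDichotomyMotifLemmas (GoodAtScale)
open Summit.AtomisticToContinuum.Crystallization.Theorems.FrustratedLawDichotomyMotifDoorE (MaybeGoodAt)
open Summit.AtomisticToContinuum.Crystallization.Theorems.FrustratedLawDichotomyRobustGoodSignature
  (robustGood_dichotomy_fcc robustGood_dichotomy_hcp robustGood_four_contacts_fcc robustGood_four_contacts_hcp)
open Summit.AtomisticToContinuum.Crystallization.Theorems.FrustratedLawDichotomyRobustGoodCoordination (shell_injective)
open Summit.AtomisticToContinuum.Crystallization.Theorems.FrustratedLawDichotomyTextureFineShells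
  (fccKissingPattern_nonempty hcpKissingPattern_nonempty)

/-! ## §1. Generic consequences of the fit clauses -/

section Generic

variable {M : ℕ} {z : Fin M → E3} {c : Fin M} {Pat : Finset E3} {d η' γ : ℝ} {A : E3 →ₗᵢ[ℝ] E3} {t : ↥Pat → E3}

/-- The shell map's radial window: `(1 − η')·d ≤ |t u − z c| ≤ (1 + η')·d` (pattern of unit vectors). [folklore] -/
theorem radial_window (hPatn : ∀ u ∈ Pat, ‖u‖ = 1) (hd : 0 ≤ d)
    (ht : ∀ u : ↥Pat, ‖(t u - z c) - d • A (u : E3)‖ ≤ η' * d) (u : ↥Pat) :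
    (1 - η') * d ≤ dist (t u) (z c) ∧ dist (t u) (z c) ≤ (1 + η') * d := by
  have hAu : ‖d • A (u : E3)‖ = d := by
    rw [norm_smul, Real.norm_of_nonneg hd, A.norm_map, hPatn u u.2, mul_one]
  have h1 := norm_add_le ((t u - z c) - d • A (u : E3)) (d • A (u : E3))
  have h2 := norm_sub_norm_le (d • A (u : E3)) ((d • A (u : E3)) - (t u - z c))
  rw [sub_add_cancel, hAu] at h1
  rw [sub_sub_cancel, hAu, norm_sub_rev] at h2
  rw [dist_eq_norm]
  constructor <;> linarith [ht u]

/-- `0 ≤ η'` (the fit inequality at any pattern vector, `d > 0`). [folklore] -/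
theorem eta_nonneg (hd : 0 < d) (hne : Pat.Nonempty) (ht : ∀ u : ↥Pat, ‖(t u - z c) - d • A (u : E3)‖ ≤ η' * d) : 0 ≤ η' := by
  obtain ⟨u, hu⟩ := hne
  have := (norm_nonneg _).trans (ht ⟨u, hu⟩)
  nlinarith

/-- The fit scale is at most the distance of ANY other atom (first pinning clause, `z` injective). [folklore] -/
theorem scale_le_dist (hz : Function.Injective z) (h1 : ∀ s : E3, s ∈ Set.range z → s ≠ z c → d ≤ dist s (z c)) {a : Fin M} (ha : a ≠ c) :
    d ≤ dist (z a) (z c) :=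
  h1 (z a) ⟨a, rfl⟩ (hz.ne ha)

/-- A lower bound of the squared nearest-neighbour distance bounds the squared fit scale (second pinning clause). [folklore] -/
theorem lower_le_scale_sq {q₀ : ℝ} (hq₀ : ∀ a, a ≠ c → q₀ ≤ dist (z a) (z c) ^ 2)
    (h2 : ∃ s : E3, s ∈ Set.range z ∧ s ≠ z c ∧ dist s (z c) ≤ d) : q₀ ≤ d ^ 2 := by
  obtain ⟨s, ⟨a, rfl⟩, hac, hle⟩ := h2
  have ha : a ≠ c := fun h => hac (congrArg z h)
  exact (hq₀ a ha).trans (pow_le_pow_left₀ dist_nonneg hle 2)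

/-- Every atom strictly below `13/10·d` of the centre (tested as `|z a − z c|² < 169/100·q₀`) is a shell atom. [folklore] -/
theorem mem_range_of_sq_lt {q₀ : ℝ} (hz : Function.Injective z) (hq₀d : q₀ ≤ d ^ 2) (hd : 0 ≤ d) (hγ : 0 < γ)
    (hgap : ∀ s : E3, s ∈ Set.range z → s ≠ z c → dist s (z c) < 13 / 10 * d + γ → dist s (z c) ≤ 13 / 10 * d - γ ∧ s ∈ Set.range t)
    {a : Fin M} (ha : a ≠ c) (hlt : dist (z a) (z c) ^ 2 < 169 / 100 * q₀) : z a ∈ Set.range t := by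
  refine (hgap (z a) ⟨a, rfl⟩ (hz.ne ha) ?_).2
  have h : dist (z a) (z c) ^ 2 < (13 / 10 * d) ^ 2 := by nlinarith
  have h' : dist (z a) (z c) < 13 / 10 * d := (pow_lt_pow_iff_left₀ dist_nonneg (by positivity) two_ne_zero).1 h
  linarith

end Generic

/-! ## §2. Badness certificates — the generic cores (pattern `Pat` of unit vectors) -/

section Cores

variable {M : ℕ} {z : Fin M → E3} {c : Fin M} {Pat : Finset E3} {d η η' γ : ℝ} {A : E3 →ₗᵢ[ℝ] E3} {t : ↥Pat → E3} {q₀ : ℝ}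

/-- RADIAL core: a first-shell atom beyond `(1+η)·|z a₁ − z c| ≥ (1+η)·d` contradicts the radial window `(1+η')·d`, `η' < η`. [folklore] -/
theorem radial_core (hz : Function.Injective z) (hPatn : ∀ u ∈ Pat, ‖u‖ = 1) (hne : Pat.Nonempty) (hd : 0 < d) (hγ : 0 < γ)
    (hη' : η' < η) (ht : ∀ u : ↥Pat, t u ∈ Set.range z ∧ ‖(t u - z c) - d • A (u : E3)‖ ≤ η' * d)
    (h1 : ∀ s : E3, s ∈ Set.range z → s ≠ z c → d ≤ dist s (z c)) (h2 : ∃ s : E3, s ∈ Set.range z ∧ s ≠ z c ∧ dist s (z c) ≤ d)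
    (hgap : ∀ s : E3, s ∈ Set.range z → s ≠ z c → dist s (z c) < 13 / 10 * d + γ → dist s (z c) ≤ 13 / 10 * d - γ ∧ s ∈ Set.range t)
    (hq₀ : ∀ a, a ≠ c → q₀ ≤ dist (z a) (z c) ^ 2) {a₁ j : Fin M} (ha₁ : a₁ ≠ c) (hj : j ≠ c)
    (hlo : (1 + η) ^ 2 * dist (z a₁) (z c) ^ 2 < dist (z j) (z c) ^ 2) (hhi : dist (z j) (z c) ^ 2 < 169 / 100 * q₀) : False := by
  have hη'0 := eta_nonneg hd hne fun u => (ht u).2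
  have hq₀d := lower_le_scale_sq hq₀ h2
  obtain ⟨u, hu⟩ := mem_range_of_sq_lt hz hq₀d hd.le hγ hgap hj hhi
  have hrad := (radial_window hPatn hd.le (fun u => (ht u).2) u).2
  rw [hu] at hrad
  have hda₁ := scale_le_dist hz h1 ha₁
  have hlt : dist (z j) (z c) < (1 + η) * dist (z a₁) (z c) := by nlinarith
  have hsq := pow_lt_pow_left₀ hlt dist_nonneg two_ne_zero
  rw [mul_pow] at hsq
  linarith

/-- THIRTEEN core: thirteen atoms below `13/10·d` would be thirteen distinct shell atoms of a twelve-point pattern. [folklore] -/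
theorem thirteen_core (hz : Function.Injective z) (hcard : Pat.card = 12) (hd : 0 ≤ d) (hγ : 0 < γ)
    (h2 : ∃ s : E3, s ∈ Set.range z ∧ s ≠ z c ∧ dist s (z c) ≤ d)
    (hgap : ∀ s : E3, s ∈ Set.range z → s ≠ z c → dist s (z c) < 13 / 10 * d + γ → dist s (z c) ≤ 13 / 10 * d - γ ∧ s ∈ Set.range t)
    (hq₀ : ∀ a, a ≠ c → q₀ ≤ dist (z a) (z c) ^ 2) (L : Finset (Fin M)) (hcL : c ∉ L) (h13 : 12 < L.card)
    (hL : ∀ j ∈ L, dist (z j) (z c) ^ 2 < 169 / 100 * q₀) : False := by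
  have hq₀d := lower_le_scale_sq hq₀ h2
  have hmem : ∀ j : ↥L, ∃ u : ↥Pat, t u = z j := fun j =>
    mem_range_of_sq_lt hz hq₀d hd hγ hgap (fun h => hcL (h ▸ j.2)) (hL j j.2)
  choose f hf using hmem
  have hinj : Function.Injective f := fun j k hjk => Subtype.ext (hz (by rw [← hf j, ← hf k, hjk]))
  have := Fintype.card_le_of_injective f hinj
  rw [Fintype.card_coe, Fintype.card_coe, hcard] at this
  omega

/-- ELEVEN core (`η' ≤ 1/20`): the shell map is injective and its twelve atoms all lie below `13/10·|z a₁ − z c|`, so they cannot fit in an index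
set of eleven. [folklore] -/
theorem eleven_core (hz : Function.Injective z) (hcard : Pat.card = 12) (hPatn : ∀ u ∈ Pat, ‖u‖ = 1)
    (hPat1 : ∀ u ∈ Pat, ∀ v ∈ Pat, u ≠ v → 1 ≤ dist u v) (hd : 0 < d) (hη' : η' ≤ 1 / 20)
    (ht : ∀ u : ↥Pat, t u ∈ Set.range z ∧ ‖(t u - z c) - d • A (u : E3)‖ ≤ η' * d)
    (h1 : ∀ s : E3, s ∈ Set.range z → s ≠ z c → d ≤ dist s (z c)) {a₁ : Fin M} (ha₁ : a₁ ≠ c)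
    (L : Finset (Fin M)) (h11 : L.card < 12) (hcov : ∀ a, a ≠ c → dist (z a) (z c) ^ 2 < 169 / 100 * dist (z a₁) (z c) ^ 2 → a ∈ L) :
    False := by
  have htinj := shell_injective hPat1 hd hη' fun u => (ht u).2
  have hda₁ := scale_le_dist hz h1 ha₁
  have hidx : ∀ u : ↥Pat, ∃ a : Fin M, a ∈ L ∧ z a = t u := by
    intro u
    obtain ⟨a, ha⟩ := (ht u).1
    have hrad := radial_window hPatn hd.le (fun u => (ht u).2) u
    have hac : a ≠ c := by
      rintro rfl
      have h := hrad.1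
      rw [← ha, dist_self] at h
      nlinarith
    refine ⟨a, hcov a hac ?_, ha⟩
    rw [ha]
    have hlt : dist (t u) (z c) < 13 / 10 * dist (z a₁) (z c) := by nlinarith [hrad.2]
    have hsq := pow_lt_pow_left₀ hlt dist_nonneg two_ne_zero
    rw [mul_pow] at hsq
    norm_num at hsq
    linarith
  choose f hfL hfz using hidx
  have hinj : Function.Injective f := fun u v huv => htinj (by rw [← hfz u, ← hfz v, huv])
  have hle : Pat.card ≤ L.card := by
    have h := Finset.card_le_card_of_injOn (s := (Finset.univ : Finset ↥Pat)) (t := L) f (fun u _ => hfL u) hinj.injOn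
    simpa using h
  omega

/-- WINDOW core (CNA dichotomy supplied as `hdich`): two shell atoms at mutual distance strictly between `11/10·|z a₁ − z c| ≥ 11/10·d` and
`131/100·√q₀ ≤ 131/100·d` are neither contacts nor far. [folklore] -/
theorem window_core (hz : Function.Injective z) (hd : 0 < d) (hγ : 0 < γ)
    (h1 : ∀ s : E3, s ∈ Set.range z → s ≠ z c → d ≤ dist s (z c)) (h2 : ∃ s : E3, s ∈ Set.range z ∧ s ≠ z c ∧ dist s (z c) ≤ d)
    (hgap : ∀ s : E3, s ∈ Set.range z → s ≠ z c → dist s (z c) < 13 / 10 * d + γ → dist s (z c) ≤ 13 / 10 * d - γ ∧ s ∈ Set.range t)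
    (hdich : ∀ u v : ↥Pat, u ≠ v → dist (t u) (t v) ≤ 11 / 10 * d ∨ 131 / 100 * d ≤ dist (t u) (t v))
    (hq₀ : ∀ a, a ≠ c → q₀ ≤ dist (z a) (z c) ^ 2) {a₁ j k : Fin M} (ha₁ : a₁ ≠ c) (hj : j ≠ c) (hk : k ≠ c) (hjk : j ≠ k)
    (hjd : dist (z j) (z c) ^ 2 < 169 / 100 * q₀) (hkd : dist (z k) (z c) ^ 2 < 169 / 100 * q₀)
    (hlo : 121 / 100 * dist (z a₁) (z c) ^ 2 < dist (z j) (z k) ^ 2) (hhi : dist (z j) (z k) ^ 2 < 17161 / 10000 * q₀) : False := by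
  have hq₀d := lower_le_scale_sq hq₀ h2
  obtain ⟨u, hu⟩ := mem_range_of_sq_lt hz hq₀d hd.le hγ hgap hj hjd
  obtain ⟨v, hv⟩ := mem_range_of_sq_lt hz hq₀d hd.le hγ hgap hk hkd
  have huv : u ≠ v := by
    rintro rfl
    exact hjk (hz (hu.symm.trans hv))
  have hda₁ := scale_le_dist hz h1 ha₁
  rcases hdich u v huv with h | h
  · rw [hu, hv] at h
    have hle : dist (z j) (z k) ≤ 11 / 10 * dist (z a₁) (z c) := by nlinarith
    have hsq := pow_le_pow_left₀ dist_nonneg hle 2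
    rw [mul_pow] at hsq
    norm_num at hsq
    linarith
  · rw [hu, hv] at h
    have h0 : (0 : ℝ) ≤ 131 / 100 * d := by positivity
    have hsq := pow_le_pow_left₀ h0 h 2
    rw [mul_pow] at hsq
    norm_num at hsq
    nlinarith

/-- FIVE-CONTACTS core (`hdich`, `hfour` supplied): five shell atoms below `131/100·d` of a shell atom are five contacts of a `4`-regular pattern.
[folklore] -/
theorem five_core (hz : Function.Injective z) (hd : 0 < d) (hγ : 0 < γ)
    (h2 : ∃ s : E3, s ∈ Set.range z ∧ s ≠ z c ∧ dist s (z c) ≤ d)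
    (hgap : ∀ s : E3, s ∈ Set.range z → s ≠ z c → dist s (z c) < 13 / 10 * d + γ → dist s (z c) ≤ 13 / 10 * d - γ ∧ s ∈ Set.range t)
    (hdich : ∀ u v : ↥Pat, u ≠ v → dist (t u) (t v) ≤ 11 / 10 * d ∨ 131 / 100 * d ≤ dist (t u) (t v))
    (hfour : ∀ u : ↥Pat, Nat.card {v : ↥Pat // v ≠ u ∧ dist (t u) (t v) ≤ 11 / 10 * d} = 4)
    (hq₀ : ∀ a, a ≠ c → q₀ ≤ dist (z a) (z c) ^ 2) {j : Fin M} (hj : j ≠ c) (hjd : dist (z j) (z c) ^ 2 < 169 / 100 * q₀)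
    (K : Finset (Fin M)) (h5 : 4 < K.card) (hjK : j ∉ K) (hcK : c ∉ K)
    (hK : ∀ k ∈ K, dist (z k) (z c) ^ 2 < 169 / 100 * q₀ ∧ dist (z j) (z k) ^ 2 < 17161 / 10000 * q₀) : False := by
  classical
  have hq₀d := lower_le_scale_sq hq₀ h2
  obtain ⟨u₀, hu₀⟩ := mem_range_of_sq_lt hz hq₀d hd.le hγ hgap hj hjd
  have hcon : ∀ k : ↥K, ∃ v : ↥Pat, v ≠ u₀ ∧ dist (t u₀) (t v) ≤ 11 / 10 * d ∧ t v = z k := by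
    intro k
    have hkc : (k : Fin M) ≠ c := fun h => hcK (h ▸ k.2)
    obtain ⟨v, hv⟩ := mem_range_of_sq_lt hz hq₀d hd.le hγ hgap hkc (hK k k.2).1
    have hvu : v ≠ u₀ := by
      rintro rfl
      exact hjK ((hz (hu₀.symm.trans hv)) ▸ k.2)
    refine ⟨v, hvu, ?_, hv⟩
    rcases hdich u₀ v hvu.symm with h | h
    · exact h
    · exfalso
      rw [hu₀, hv] at h
      have h0 : (0 : ℝ) ≤ 131 / 100 * d := by positivity
      have hsq := pow_le_pow_left₀ h0 h 2
      rw [mul_pow] at hsq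
      norm_num at hsq
      nlinarith [(hK k k.2).2]
  choose f hf1 hf2 hf3 using hcon
  let F : ↥K → {v : ↥Pat // v ≠ u₀ ∧ dist (t u₀) (t v) ≤ 11 / 10 * d} := fun k => ⟨f k, hf1 k, hf2 k⟩
  have hinj : Function.Injective F := by
    intro k k' h
    have h' : f k = f k' := congrArg Subtype.val h
    exact Subtype.ext (hz (by rw [← hf3 k, ← hf3 k', h']))
  have hle := Nat.card_le_card_of_injective F hinj
  rw [hfour u₀, Nat.card_eq_fintype_card, Fintype.card_coe] at hle
  omega

end Cores

/-! ## §2'. Pattern facts in the shape the cores consume -/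

/-- CNA dichotomy of an fcc shell, weak form (`η' ≤ 1/20`). [folklore] -/
theorem dichotomy_fcc {p : E3} {d η' : ℝ} (hd : 0 ≤ d) (hη' : η' ≤ 1 / 20) {A : E3 →ₗᵢ[ℝ] E3} {t : ↥fccKissingPattern → E3}
    (ht : ∀ u : ↥fccKissingPattern, ‖(t u - p) - d • A (u : E3)‖ ≤ η' * d) (u v : ↥fccKissingPattern) (huv : u ≠ v) :
    dist (t u) (t v) ≤ 11 / 10 * d ∨ 131 / 100 * d ≤ dist (t u) (t v) := by
  rcases robustGood_dichotomy_fcc hd hη' ht u v huv with ⟨-, h⟩ | ⟨-, h⟩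
  · exact Or.inl h
  · exact Or.inr h

/-- CNA dichotomy of an hcp shell, weak form (`η' ≤ 1/20`). [folklore] -/
theorem dichotomy_hcp {p : E3} {d η' : ℝ} (hd : 0 ≤ d) (hη' : η' ≤ 1 / 20) {A : E3 →ₗᵢ[ℝ] E3} {t : ↥hcpKissingPattern → E3}
    (ht : ∀ u : ↥hcpKissingPattern, ‖(t u - p) - d • A (u : E3)‖ ≤ η' * d) (u v : ↥hcpKissingPattern) (huv : u ≠ v) :
    dist (t u) (t v) ≤ 11 / 10 * d ∨ 131 / 100 * d ≤ dist (t u) (t v) := by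
  rcases robustGood_dichotomy_hcp hd hη' ht u v huv with ⟨-, h⟩ | ⟨-, h⟩
  · exact Or.inl h
  · exact Or.inr h

/-! ## §2''. BADNESS CERTIFICATES `⟹ ¬ GoodAt η z c` -/

section Badness

variable {M : ℕ} {z : Fin M → E3} {c : Fin M} {η q₀ : ℝ}

/-- ★ **RADIAL badness certificate** (any `η`): `q₀ ≤ nn²`, an atom `j ≠ c` with `(1+η)²·|z a₁ − z c|² < |z j − z c|² < 169/100·q₀` for some
`a₁ ≠ c` ⟹ `¬ GoodAt η z c`.  (The misfit of every isometric fit at the pinned scale `d = nn` is at least the radial spread of the first shell.)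
[folklore] -/
theorem not_goodAt_of_radial (hz : Function.Injective z) (hq₀ : ∀ a, a ≠ c → q₀ ≤ dist (z a) (z c) ^ 2) {a₁ j : Fin M} (ha₁ : a₁ ≠ c)
    (hj : j ≠ c) (hlo : (1 + η) ^ 2 * dist (z a₁) (z c) ^ 2 < dist (z j) (z c) ^ 2) (hhi : dist (z j) (z c) ^ 2 < 169 / 100 * q₀) :
    ¬ GoodAt η z c := by
  rintro ⟨d, η', γ, A, hor⟩
  rcases hor with ⟨t, hd, hγ, hη', ht, h1, h2, hgap⟩ | ⟨t, hd, hγ, hη', ht, h1, h2, hgap⟩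
  · exact radial_core hz (fun u hu => norm_eq_one_of_mem_fccKissingPattern hu) fccKissingPattern_nonempty hd hγ hη' ht h1 h2 hgap hq₀ ha₁ hj hlo hhi
  · exact radial_core hz (fun u hu => norm_eq_one_of_mem_hcpKissingPattern hu) hcpKissingPattern_nonempty hd hγ hη' ht h1 h2 hgap hq₀ ha₁ hj hlo hhi

/-- ★ **THIRTEEN-NEIGHBOURS badness certificate** (any `η`): thirteen atoms other than `c` at squared distance `< 169/100·q₀` ⟹ `¬ GoodAt η z c`.
[folklore] -/
theorem not_goodAt_of_thirteen (hz : Function.Injective z) (hq₀ : ∀ a, a ≠ c → q₀ ≤ dist (z a) (z c) ^ 2) (L : Finset (Fin M))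
    (hcL : c ∉ L) (h13 : 12 < L.card) (hL : ∀ j ∈ L, dist (z j) (z c) ^ 2 < 169 / 100 * q₀) : ¬ GoodAt η z c := by
  rintro ⟨d, η', γ, A, hor⟩
  rcases hor with ⟨t, hd, hγ, -, -, -, h2, hgap⟩ | ⟨t, hd, hγ, -, -, -, h2, hgap⟩
  · exact thirteen_core hz card_fccKissingPattern hd.le hγ h2 hgap hq₀ L hcL h13 hL
  · exact thirteen_core hz card_hcpKissingPattern hd.le hγ h2 hgap hq₀ L hcL h13 hL

/-- ★ **ELEVEN-NEIGHBOURS badness certificate** (`η ≤ 1/20`): an index set `L` of at most eleven elements containing every `a ≠ c` with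
`|z a − z c|² < 169/100·|z a₁ − z c|²` (`a₁ ≠ c`) ⟹ `¬ GoodAt η z c` (vacancy / under-coordination). [folklore] -/
theorem not_goodAt_of_eleven (hz : Function.Injective z) (hη : η ≤ 1 / 20) {a₁ : Fin M} (ha₁ : a₁ ≠ c) (L : Finset (Fin M))
    (h11 : L.card < 12) (hcov : ∀ a, a ≠ c → dist (z a) (z c) ^ 2 < 169 / 100 * dist (z a₁) (z c) ^ 2 → a ∈ L) : ¬ GoodAt η z c := by
  rintro ⟨d, η', γ, A, hor⟩
  rcases hor with ⟨t, hd, -, hη', ht, h1, -, -⟩ | ⟨t, hd, -, hη', ht, h1, -, -⟩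
  · exact eleven_core hz card_fccKissingPattern (fun u hu => norm_eq_one_of_mem_fccKissingPattern hu)
      (fun u hu v hv huv => one_le_dist_of_mem_fccKissingPattern hu hv huv) hd (hη'.le.trans hη) ht h1 ha₁ L h11 hcov
  · exact eleven_core hz card_hcpKissingPattern (fun u hu => norm_eq_one_of_mem_hcpKissingPattern hu)
      (fun u hu v hv huv => one_le_dist_of_mem_hcpKissingPattern hu hv huv) hd (hη'.le.trans hη) ht h1 ha₁ L h11 hcov

/-- ★ **FORBIDDEN-WINDOW badness certificate** (`η ≤ 1/20`): two atoms `j ≠ k` (both `≠ c`, both at squared distance `< 169/100·q₀` from the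
centre) at squared mutual distance in `(121/100·|z a₁ − z c|², 17161/10000·q₀)` ⟹ `¬ GoodAt η z c` — a first-shell pair that is neither a pattern
contact (`≤ 11/10·d`) nor a pattern non-contact (`≥ 131/100·d`). [folklore] -/
theorem not_goodAt_of_window (hz : Function.Injective z) (hη : η ≤ 1 / 20) (hq₀ : ∀ a, a ≠ c → q₀ ≤ dist (z a) (z c) ^ 2)
    {a₁ j k : Fin M} (ha₁ : a₁ ≠ c) (hj : j ≠ c) (hk : k ≠ c) (hjk : j ≠ k) (hjd : dist (z j) (z c) ^ 2 < 169 / 100 * q₀)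
    (hkd : dist (z k) (z c) ^ 2 < 169 / 100 * q₀) (hlo : 121 / 100 * dist (z a₁) (z c) ^ 2 < dist (z j) (z k) ^ 2)
    (hhi : dist (z j) (z k) ^ 2 < 17161 / 10000 * q₀) : ¬ GoodAt η z c := by
  rintro ⟨d, η', γ, A, hor⟩
  rcases hor with ⟨t, hd, hγ, hη', ht, h1, h2, hgap⟩ | ⟨t, hd, hγ, hη', ht, h1, h2, hgap⟩
  · exact window_core hz hd hγ h1 h2 hgap (dichotomy_fcc hd.le (hη'.le.trans hη) fun u => (ht u).2) hq₀ ha₁ hj hk hjk hjd hkd hlo hhi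
  · exact window_core hz hd hγ h1 h2 hgap (dichotomy_hcp hd.le (hη'.le.trans hη) fun u => (ht u).2) hq₀ ha₁ hj hk hjk hjd hkd hlo hhi

/-- ★ **FIVE-CONTACTS badness certificate** (`η ≤ 1/20`): a first-shell atom `j` and a set `K` of five further first-shell atoms (`j, c ∉ K`)
each at squared distance `< 17161/10000·q₀` from `z j` ⟹ `¬ GoodAt η z c` (both kissing patterns are `4`-regular: the icosahedral `555` signature
and every over-coordinated shell fail here). [folklore] -/
theorem not_goodAt_of_fiveContacts (hz : Function.Injective z) (hη : η ≤ 1 / 20) (hq₀ : ∀ a, a ≠ c → q₀ ≤ dist (z a) (z c) ^ 2)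
    {j : Fin M} (hj : j ≠ c) (hjd : dist (z j) (z c) ^ 2 < 169 / 100 * q₀) (K : Finset (Fin M)) (h5 : 4 < K.card) (hjK : j ∉ K)
    (hcK : c ∉ K) (hK : ∀ k ∈ K, dist (z k) (z c) ^ 2 < 169 / 100 * q₀ ∧ dist (z j) (z k) ^ 2 < 17161 / 10000 * q₀) :
    ¬ GoodAt η z c := by
  rintro ⟨d, η', γ, A, hor⟩
  rcases hor with ⟨t, hd, hγ, hη', ht, -, h2, hgap⟩ | ⟨t, hd, hγ, hη', ht, -, h2, hgap⟩
  · exact five_core hz hd hγ h2 hgap (dichotomy_fcc hd.le (hη'.le.trans hη) fun u => (ht u).2)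
      (robustGood_four_contacts_fcc hd (hη'.le.trans hη) fun u => (ht u).2) hq₀ hj hjd K h5 hjK hcK hK
  · exact five_core hz hd hγ h2 hgap (dichotomy_hcp hd.le (hη'.le.trans hη) fun u => (ht u).2)
      (robustGood_four_contacts_hcp hd (hη'.le.trans hη) fun u => (ht u).2) hq₀ hj hjd K h5 hjK hcK hK

/-! ## §3. Glue to the kernel's flags -/

/-- `¬ GoodAt η ⟹ ¬ GoodAtScale η D` (the cap only adds a clause). [folklore] -/
theorem not_goodAtScale_of_not_goodAt {D : ℝ} (h : ¬ GoodAt η z c) : ¬ GoodAtScale η D z c := fun hg => h hg.goodAt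

/-- ★ `¬ GoodAt η` and SOME other atom within `D` of the centre ⟹ `¬ MaybeGoodAt η D z c` — the badness flag of
`…PeriodicBlockViolation.not_pairLevelLaw_of_cell`. [folklore] -/
theorem not_maybeGoodAt_of_not_goodAt {D : ℝ} (h : ¬ GoodAt η z c) {a : Fin M} (ha : a ≠ c) (haD : dist (z a) (z c) ≤ D) :
    ¬ MaybeGoodAt η D z c := by
  rintro (hg | hfar)
  · exact h hg.goodAt
  · exact absurd haD (not_le.2 (hfar a ha))

/-- The «within `D`» side condition from squared data: `|z a − z c|² ≤ D²`, `0 ≤ D`. [folklore] -/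
theorem dist_le_of_sq_le {D : ℝ} (hD : 0 ≤ D) {a : Fin M} (h : dist (z a) (z c) ^ 2 ≤ D ^ 2) : dist (z a) (z c) ≤ D :=
  (pow_le_pow_iff_left₀ dist_nonneg hD two_ne_zero).1 h

end Badness

end Summit.AtomisticToContinuum.Crystallization.Theorems.FrustratedLawDichotomyShellBadnessCert

end
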